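import Summits.QuantumFields.BalabanUV.Beta.GAN24.FibreUniformBoundOfParts
import Summits.QuantumFields.BalabanUV.Beta.GAN24.ScaledPartFM

/-!
# `BalabanUV.Beta.GAN24.ScaledPartMM` — binder row G-an2-4 / (CONV-C), road P1-fibre, leaf **P1-L09** `FibreUniformBound`, part H4:
# the MULTIPLIER–MULTIPLIER scaled part `s_m(j)² · ‖φ[e_l]‖ ≤ K₄` at `d = 3` (`D = 4`), N-uniformly — `FibreUniformBound.ScaledMM Lc (smStep 3 Lc) K₄` DISCHARGED

NOT IN PRINT; OUR PROOF ATTEMPT.  HONEST FRAMING (cell contract, verbatim): «discharging `BetaPertH` makes Bałaban's UV stability UNCONDITIONAL — a real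
constructive-QFT result; it is NOT the continuum limit and NOT the Clay problem.»  HONEST DEPENDENCY (verbatim): «continuum YM on T⁴ ⇐ BetaPertH ∧ nine spine
estimates (0/9 proved); BetaPertH ⇐ (D1) ∧ (D4) ∧ CAP+tail; G-an2-4 gates asym, D1 and NE2/3/4.»  [folklore] bookkeeping over leaf-20's endpoint bound as packaged
by leaf-17 (`ScaledPartFM.norm_phiSol_constraint_le`: `‖phiSol N p 0 (eVec l) κ‖ ≤ cPP D·|q|²/N^{D+4}`, BY NAME); no new estimate, no cited fact, no wall binder.
NOT summit progress; nothing of (CONV-C)'s K-slot is discharged here.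

## What is proved
* `smStep_sq_div`: the unit/volume power count at `D = 4`: `smStep 3 Lc j ^ 2 / (Lc^(j+1))^8 = 1/Lc^8` (`s_m(j) = Lc^{4j} = M⁴`, `N = Lc^{j+1}`).
* **`scaledMM_step`**: `ScaledMM (d := 3) Lc (smStep 3 Lc) (cPP 4 · 4π²)` — for every step `j`, every `q ∈ BZ 4 ∖ {0}` and all `κ, l`:
  `smStep 3 Lc j ^ 2 · ‖phiSol (Lc^(j+1)) (ofRealVec q) 0 (eVec l) κ‖ ≤ cPP 4 · 4π²` (in fact `≤ cPP 4 · |q|²/Lc⁸`); the power count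
  `s_m²·|q|²/N^{D+4} = |q|²·M^{D−4}/Lc^{D+4}` closes EXACTLY at `D = 4`.
Unit `b2b-balaban-gan24-formalise-leaf-05` (G-an2-4 formalisation swarm), 2026-08-20.
-/

noncomputable section

open scoped Real
open Literature.MathematicalPhysics.QuantumFieldTheory
open Literature.MathematicalPhysics.QuantumFieldTheory.Balaban1983to89
open Literature.MathematicalPhysics.QuantumFieldTheory.King1986 (momSq momSq_nonneg momSq_le_card_mul_pi_sq)
open B4Strip (ofRealVec)
open B4ContourShift (BZ)
open Summit.QuantumFields.BalabanUV.Beta.GAN24.CombesThomas (smStep)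
open Summit.QuantumFields.BalabanUV.Beta.GAN24.AliasObjects (phiSol eVec)
open Summit.QuantumFields.BalabanUV.Beta.GAN24.CapacitanceEndpointBlocks (cPP cPP_pos)
open Summit.QuantumFields.BalabanUV.Beta.GAN24.ScaledPartFM (norm_phiSol_constraint_le)

namespace Summit.QuantumFields.BalabanUV.Beta.GAN24.FibreUniformBound

/-- [folklore] The unit/volume power count at `D = 4`: `s_m(j)² / N^8 = 1/Lc^8` (`s_m(j) = Lc^{4j}`, `N = Lc^{j+1}`). -/
theorem smStep_sq_div (Lc : ℕ) [NeZero Lc] (j : ℕ) :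
    smStep 3 Lc j ^ 2 / (((Lc ^ (j + 1) : ℕ) : ℝ)) ^ (3 + 1 + 4) = 1 / (Lc : ℝ) ^ 8 := by
  have hLc : (Lc : ℝ) ≠ 0 := Nat.cast_ne_zero.2 (NeZero.ne Lc)
  unfold smStep
  push_cast
  rw [div_eq_div_iff (pow_ne_zero _ (pow_ne_zero _ hLc)) (pow_ne_zero _ hLc), one_mul, ← pow_mul, ← pow_mul, ← pow_add]
  congr 1
  ring

/-- [folklore] **H4 DISCHARGED at `d = 3`**: `ScaledMM Lc (smStep 3 Lc) (cPP 4 · (4π²))` — for every step `j`, every `q ∈ BZ 4 ∖ {0}` and all `κ, l`: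
`smStep 3 Lc j ^ 2 · ‖phiSol (Lc^(j+1)) (ofRealVec q) 0 (eVec l) κ‖ ≤ cPP 4 · 4π²` (in fact `≤ cPP 4 · |q|²/Lc⁸`). -/
theorem scaledMM_step (Lc : ℕ) [NeZero Lc] : ScaledMM (d := 3) Lc (smStep 3 Lc) (cPP 4 * (4 * π ^ 2)) := by
  intro j q hq hq0 κ l
  have hqi : ∀ i, |q i| ≤ π := fun i => abs_le.mpr ⟨hq.1 i, hq.2 i⟩
  have hLcpos : 0 < Lc := Nat.pos_of_ne_zero (NeZero.ne Lc)
  have hN : 1 ≤ Lc ^ (j + 1) := Nat.one_le_pow _ _ hLcpos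
  have h := norm_phiSol_constraint_le (N := Lc ^ (j + 1)) hN hqi hq0 l κ
  have hmom : momSq q ≤ 4 * π ^ 2 := by
    have := momSq_le_card_mul_pi_sq hqi
    norm_num at this
    exact this
  have hmom0 : 0 ≤ momSq q := momSq_nonneg q
  have hcPP : 0 ≤ cPP 4 := (cPP_pos 4).le
  have hLc1 : (1 : ℝ) ≤ (Lc : ℝ) ^ 8 := one_le_pow₀ (by exact_mod_cast hLcpos)
  calc smStep 3 Lc j ^ 2 * ‖phiSol (Lc ^ (j + 1)) (ofRealVec q) 0 (eVec l) κ‖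
      ≤ smStep 3 Lc j ^ 2 * (cPP (3 + 1) * momSq q / (((Lc ^ (j + 1) : ℕ) : ℝ)) ^ (3 + 1 + 4)) :=
        mul_le_mul_of_nonneg_left h (sq_nonneg _)
    _ = cPP 4 * momSq q * (smStep 3 Lc j ^ 2 / (((Lc ^ (j + 1) : ℕ) : ℝ)) ^ (3 + 1 + 4)) := by ring
    _ = cPP 4 * momSq q / (Lc : ℝ) ^ 8 := by rw [smStep_sq_div]; ring
    _ ≤ cPP 4 * momSq q := div_le_self (mul_nonneg hcPP hmom0) hLc1
    _ ≤ cPP 4 * (4 * π ^ 2) := mul_le_mul_of_nonneg_left hmom hcPP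

end Summit.QuantumFields.BalabanUV.Beta.GAN24.FibreUniformBound

end
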